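import Summits.MatrixMultiplication.MatrixMultiplication.Theorems.FarEdgeDescentTameProfile
import Mathlib.Analysis.Calculus.Deriv.Slope
import HarnessLib

/-!
# Route `FarEdgeDescent` — the REGULARITY CUT `ω(ℂ) = 2 ⟺ TameProfile ∧ SmoothProfile`

Support module (def-free) for the asides `SmoothProfile` (gen 21) and `TameProfile`
(stmt-MatrixMultiplication-31917, gen 11) of the route
`Summits/MatrixMultiplication/MatrixMultiplication/Theses/FarEdgeDescent.lean`; imports only BUILT modules and
restates nothing (saturation, `excess_antitone`, `mm_of_saturation_near_square`, `finiteSaturation_of_tameProfile`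
are used by name).

Write `f(m) := ω(1,m,1)` (exponent of `⟨n, n^m, n⟩`) and `e(m) := f(m) − (m+1) ≥ 0`.  Every earlier cut of this
route pairs a CONTACT statement on the special side (`FiniteSaturation`: `e` has a zero; `SuperExpContact`,
`SuperFactorialContact`: fast contact) with a MULTIPLICATIVE LAW on the generic side (`AnchoredLogConvexity`,
`BoundedDoublingDefect`, `SummableLogDefect`, `ExpDoublingDefect`: `e(m)² ≤ D(m)·e(1)·e(2m−1)`), read by the
halving engine.  This module files a cut of a DIFFERENT KIND — both leaves are TAMENESS / REGULARITY statements
about the far-edge profile, and the engine is TRANSVERSALITY: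

* special leaf `TameProfile` (31917): `f` is semilinear on `[1, ∞)` (a finite maximum of affine functions —
  «the spectrum body `Δ_MM` is polyhedral near the far edge»);
* generic leaf `SmoothProfile` (new aside): `f` is differentiable at every shape `x > 1` («the exponent of
  `⟨n, n^x, n⟩` has no first-order phase transition in `x`»).

**THEOREM (`node_tameSmooth_iff`, 0 sorry): `ω(ℂ) = 2 ⟺ TameProfile ∧ SmoothProfile`.**  Proof (§2–§3):
`TameProfile → FiniteSaturation` makes `f = m + 1` from some shape on, so every affine piece has slope `≤ 1`
(and intercept `≤ 1` if the slope is `1`); let `b` be the last crossing of a piece of slope `< 1` with the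
information line `m + 1`.  Beyond `b` the profile is saturated.  If `b ≤ 1`, saturation at shapes arbitrarily
close to the square gives `ω = 2` (`mm_of_saturation_near_square`, Lotti–Romani).  If `b > 1`, the piece through
`(b, b+1)` has slope `a < 1` and supports `f` from below on `[1, b]`: a TRANSVERSAL CONTACT
(`transversal_of_tameProfile_of_not_mm`), at which the left difference quotients are `≤ a < 1 =` the right ones,
so `f` is not differentiable at `b` (`not_differentiableAt_of_slope_gap`, a pure real lemma from
`hasDerivAt_iff_tendsto_slope`).  Necessity: `ω = 2 ⟹ f = m + 1` on `[1, ∞)` (saturation) `⟹` smooth on `(1, ∞)`.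

**HONESTY (§5).**  Used contents: `TameProfile` gives `ω = 2 ∨ TC`, `SmoothProfile` gives `¬TC`, where the
transversal contact `TC :⟺ ∃ b > 1, a < 1, f = m+1 on [b, ∞) ∧ f(x) ≥ f(b) − a(b−x) on [1, b]` satisfies
`TC → ω > 2` and `TC → FiniteSaturation`; hence `¬TC ⟺ (TC → ω = 2)` is a residual statement, implied by the
record's law (`AnchoredLogConvexity → ¬TC`) and even by the record's residual (`(FiniteSaturation → ω = 2) → ¬TC`).
At used-content level the regularity leaf asks LESS than every law of the dial; the information of the cut is
the PAIRING — tameness forces transversality — and differentiability is used only AT saturated shapes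
(`closes_tameSmoothAtZeros`).  PLACEMENT against the cut of record (`FiniteSaturation`, `AnchoredLogConvexity`):
special leaf STRONGER (`TameProfile ⟹ FiniteSaturation`), generic leaf INCOMPARABLE with the law (model worlds in
`FarEdgeDescentSmoothWorlds`: a convex tangential world `x + 1 + (2−x)₊²/4` has `FiniteSaturation`-, `Smooth`- and
`ω > 2`-shape and violates the law — so (`FiniteSaturation`, `SmoothProfile`) is NO cut and the stronger special
leaf is forced — while a kinked log-convex world obeys the law and is not smooth).  `SmoothProfile` is NECESSARY,
not known, and moot in-class: every method profile (the CW_q / laser families behind the rectangular tables) is a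
zero-free real-analytic upper bound.  In print `k ↦ ω(1,k,1)` is known to be convex, non-decreasing and
1-Lipschitz [cite: LottiRomani1983, §2 and Prop. 4.1] [cite: HuangPan1998, §8]; no differentiability or kink
statement was found (searches recorded in the lens cell's NODE-v21.md).

Written by the decomp-mm lens-2 planner seat (gen 21).
-/

set_option linter.dupNamespace false

noncomputable section

namespace Summit.MatrixMultiplication.MatrixMultiplication.Theorems.FarEdgeDescentSmoothCut

open Literature.Computability.AlgebraicComplexity
open Summit.MatrixMultiplication.MatrixMultiplication.Theses.FarEdgeDescent
open Summit.MatrixMultiplication.MatrixMultiplication.Theorems.FarEdgeDescentChord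
open Summit.MatrixMultiplication.MatrixMultiplication.Theorems.FarEdgeDescentTameProfile
open Filter Topology Set Asymptotics

/-! ## §1 Pure real lemma: a slope gap at a point forbids differentiability there -/

/-- `𝓝[<] b ≤ 𝓝[≠] b` (folklore). -/
theorem nhdsLT_le_nhdsNE' (b : ℝ) : 𝓝[<] b ≤ 𝓝[≠] b :=
  nhdsWithin_mono _ fun _ hx => ne_of_lt (mem_Iio.1 hx)

/-- `𝓝[>] b ≤ 𝓝[≠] b` (folklore). -/
theorem nhdsGT_le_nhdsNE' (b : ℝ) : 𝓝[>] b ≤ 𝓝[≠] b :=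
  nhdsWithin_mono _ fun _ hx => ne_of_gt (mem_Ioi.1 hx)

/-- If the left difference quotients of `f` at `b` are eventually `≤ a` and the right ones eventually
`≥ a'` with `a < a'` (a CONVEX CORNER), then `f` is not differentiable at `b`. -/
theorem not_differentiableAt_of_slope_gap {f : ℝ → ℝ} {b a a' : ℝ} (haa : a < a')
    (hleft : ∀ᶠ x in 𝓝[<] b, slope f b x ≤ a) (hright : ∀ᶠ y in 𝓝[>] b, a' ≤ slope f b y) :
    ¬ DifferentiableAt ℝ f b := by
  intro hd
  have h := hasDerivAt_iff_tendsto_slope.1 hd.hasDerivAt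
  have h₁ : deriv f b ≤ a := le_of_tendsto (h.mono_left (nhdsLT_le_nhdsNE' b)) hleft
  have h₂ : a' ≤ deriv f b := ge_of_tendsto (h.mono_left (nhdsGT_le_nhdsNE' b)) hright
  linarith

/-! ## §2 The last kink of a tame profile is a TRANSVERSAL contact -/

/-- **The last kink.**  If the far-edge profile is semilinear (`TameProfile`) and `ω > 2`, then there are
a shape `b > 1` and a slope `a < 1` with: the profile is saturated from `b` on (`ω(1,y,1) = y + 1` for
`y ≥ b`) and lies above the line of slope `a` through `(b, b+1)` on `[1, b]` — the information line
`m ↦ m + 1` is reached TRANSVERSALLY at `b`. -/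
theorem transversal_of_tameProfile_of_not_mm (hT : TameProfile) (hS : ¬ _root_.MatrixMultiplication) :
    ∃ b a : ℝ, 1 < b ∧ a < 1 ∧ (∀ y : ℝ, b ≤ y → omegaRect ℂ 1 y 1 = y + 1) ∧
      ∀ x : ℝ, 1 ≤ x → x ≤ b → omegaRect ℂ 1 b 1 - a * (b - x) ≤ omegaRect ℂ 1 x 1 := by
  classical
  obtain ⟨N, α, β, hT⟩ := hT
  obtain ⟨k₀, hk₀, hsat⟩ := finiteSaturation_of_tameProfile ⟨N, α, β, hT⟩
  have hk₀1 : (1 : ℝ) ≤ k₀ := by exact_mod_cast (by omega : 1 ≤ k₀)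
  -- saturation at every real shape `≥ k₀`
  have hsatk : ∀ y : ℝ, (k₀ : ℝ) ≤ y → omegaRect ℂ 1 y 1 = y + 1 := by
    intro y hy
    have h1 := excess_antitone (x := y) (y := (k₀ : ℝ)) hy
    have h0 := add_one_le_omegaRect_one_mid_one ℂ y
    rw [hsat] at h1
    linarith
  -- each piece lies below the profile
  have hpiece : ∀ i, ∀ m : ℝ, 1 ≤ m → α i * m + β i ≤ omegaRect ℂ 1 m 1 :=
    fun i m hm => (hT m hm).2 ⟨i, rfl⟩
  -- slopes are `≤ 1`
  have hα : ∀ i, α i ≤ 1 := by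
    refine fun i => not_lt.1 fun h => ?_
    obtain ⟨m, hm⟩ : ∃ m : ℝ, m = max (k₀ : ℝ) ((1 - β i) / (α i - 1) + 1) := ⟨_, rfl⟩
    have hm1 : 1 ≤ m := le_trans hk₀1 (hm ▸ le_max_left _ _)
    have h1 := hpiece i m hm1
    rw [hsatk m (hm ▸ le_max_left _ _)] at h1
    have h2 : (1 - β i) / (α i - 1) + 1 ≤ m := hm ▸ le_max_right _ _
    have h3 : (1 - β i) / (α i - 1) < m := by linarith
    rw [div_lt_iff₀ (by linarith)] at h3
    have h4 : m * (α i - 1) = α i * m - m := by ring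
    linarith
  -- slope-one pieces have intercept `≤ 1`
  have hβ : ∀ i, α i = 1 → β i ≤ 1 := by
    intro i hi
    have h1 := hpiece i k₀ hk₀1
    rw [hsatk k₀ le_rfl, hi] at h1
    linarith
  -- the crossing points `c i` of the pieces of slope `< 1` with the information line, and the last one
  obtain ⟨c, hc⟩ : ∃ c : Fin (N + 1) → ℝ, c = fun i => if α i < 1 then (β i - 1) / (1 - α i) else 1 :=
    ⟨_, rfl⟩
  obtain ⟨j, -, hj⟩ := Finset.exists_max_image Finset.univ c Finset.univ_nonempty
  obtain ⟨b, hb⟩ : ∃ b : ℝ, b = max 1 (c j) := ⟨_, rfl⟩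
  -- beyond `b` every piece is `≤ m + 1`, hence the profile is saturated
  have hsat_b : ∀ m : ℝ, b < m → omegaRect ℂ 1 m 1 = m + 1 := by
    intro m hm
    have hm1 : 1 ≤ m := le_of_lt (lt_of_le_of_lt (hb ▸ le_max_left _ _) hm)
    obtain ⟨⟨i, hi⟩, -⟩ := hT m hm1
    refine le_antisymm ?_ (add_one_le_omegaRect_one_mid_one ℂ m)
    rw [← hi]
    have hci : c i ≤ c j := hj i (Finset.mem_univ _)
    have hcb : c j < m := lt_of_le_of_lt (hb ▸ le_max_right _ _) hm
    rcases lt_or_eq_of_le (hα i) with hlt | heq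
    · have hci' : c i = (β i - 1) / (1 - α i) := by rw [hc]; exact if_pos hlt
      have h3 : (β i - 1) / (1 - α i) < m := by rw [← hci']; linarith
      rw [div_lt_iff₀ (by linarith)] at h3
      have h4 : m * (1 - α i) = m - α i * m := by ring
      show α i * m + β i ≤ m + 1
      linarith
    · show α i * m + β i ≤ m + 1
      rw [heq, one_mul]; linarith [hβ i heq]
  -- … and at `b` itself (monotonicity of the profile)
  have hsat_ge : ∀ y : ℝ, b ≤ y → omegaRect ℂ 1 y 1 = y + 1 := by
    intro y hy
    rcases lt_or_eq_of_le hy with hlt | heq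
    · exact hsat_b y hlt
    · refine le_antisymm (not_lt.1 fun hcon => ?_) (add_one_le_omegaRect_one_mid_one ℂ y)
      have hmono := omegaRect_one_mid_one_mono ℂ
        (show y ≤ y + (omegaRect ℂ 1 y 1 - (y + 1)) / 2 by linarith)
      have h2 := hsat_b (y + (omegaRect ℂ 1 y 1 - (y + 1)) / 2) (by rw [heq]; linarith)
      linarith
  rcases eq_or_lt_of_le (show (1 : ℝ) ≤ b from hb ▸ le_max_left _ _) with hb1 | hb1
  · -- `b = 1`: saturation arbitrarily close to the square ⟹ `ω = 2`
    exfalso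
    refine hS (mm_of_saturation_near_square fun ε hε => ⟨1 + ε / 2, by linarith, by linarith, ?_⟩)
    exact hsat_b _ (by rw [← hb1]; linarith)
  · -- `b > 1`: then `b = c j` with `α j < 1`, and piece `j` passes through `(b, b + 1)`
    have hcj1 : 1 < c j := by
      have := hb ▸ hb1
      rcases lt_max_iff.1 this with h | h
      · exact absurd h (lt_irrefl _)
      · exact h
    have hαj : α j < 1 := by
      by_contra h
      have : c j = 1 := by rw [hc]; exact if_neg h
      rw [this] at hcj1
      exact lt_irrefl _ hcj1
    have hbc : b = c j := by rw [hb]; exact max_eq_right hcj1.le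
    have hcj : c j = (β j - 1) / (1 - α j) := by rw [hc]; exact if_pos hαj
    have hβj : β j = 1 + b * (1 - α j) := by
      rw [hbc, hcj, div_mul_cancel₀ _ (by linarith : (1 - α j) ≠ 0)]; ring
    refine ⟨b, α j, hb1, hαj, hsat_ge, fun x hx hxb => ?_⟩
    rw [hsat_ge b le_rfl]
    have h1 := hpiece j x hx
    rw [hβj] at h1
    have h4 : α j * (b - x) = α j * b - α j * x := by ring
    nlinarith

/-- **A transversal contact is a corner**: at such a `b` the profile has left difference quotients
`≤ a < 1` and right difference quotients `= 1`, so it is not differentiable at `b`. -/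
theorem not_differentiableAt_of_transversal {b a : ℝ} (hb : 1 < b) (ha : a < 1)
    (hright : ∀ y : ℝ, b ≤ y → omegaRect ℂ 1 y 1 = y + 1)
    (hleft : ∀ x : ℝ, 1 ≤ x → x ≤ b → omegaRect ℂ 1 b 1 - a * (b - x) ≤ omegaRect ℂ 1 x 1) :
    ¬ DifferentiableAt ℝ (fun y : ℝ => omegaRect ℂ 1 y 1) b := by
  refine not_differentiableAt_of_slope_gap ha ?_ ?_
  · filter_upwards [Ioo_mem_nhdsLT hb] with x hx
    rw [slope_def_field]
    have h1 := hleft x hx.1.le hx.2.le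
    have hxb : x - b < 0 := by linarith [hx.2]
    rw [div_le_iff_of_neg hxb]
    linarith
  · filter_upwards [self_mem_nhdsWithin] with y hy
    have hy' : b < y := hy
    rw [slope_def_field, hright y hy'.le, hright b le_rfl, le_div_iff₀ (by linarith)]
    linarith

/-! ## §3 The regularity cut: deciding theorem, necessity, exactness -/

/-- ★ **DECIDING THEOREM of the regularity cut** (spelled form):
`TameProfile → (ω(1,·,1) differentiable at every shape > 1) → ω(ℂ) = 2`.
A tame world with `ω > 2` has a transversal last kink (§2), which is a point of non-differentiability. -/
theorem closes_tameSmooth (hT : TameProfile)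
    (hD : ∀ x : ℝ, 1 < x → DifferentiableAt ℝ (fun y : ℝ => omegaRect ℂ 1 y 1) x) :
    _root_.MatrixMultiplication := by
  by_contra hS
  obtain ⟨b, a, hb, ha, hright, hleft⟩ := transversal_of_tameProfile_of_not_mm hT hS
  exact not_differentiableAt_of_transversal hb ha hright hleft (hD b hb)

/-- **Weakest regularity form.**  Differentiability is used only AT SATURATED SHAPES:
`TameProfile → (∀ x > 1, ω(1,x,1) = x + 1 → f differentiable at x) → ω(ℂ) = 2`. -/
theorem closes_tameSmoothAtZeros (hT : TameProfile)
    (hD : ∀ x : ℝ, 1 < x → omegaRect ℂ 1 x 1 = x + 1 → DifferentiableAt ℝ (fun y : ℝ => omegaRect ℂ 1 y 1) x) :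
    _root_.MatrixMultiplication := by
  by_contra hS
  obtain ⟨b, a, hb, ha, hright, hleft⟩ := transversal_of_tameProfile_of_not_mm hT hS
  exact not_differentiableAt_of_transversal hb ha hright hleft (hD b hb (hright b le_rfl))

/-- **NECESSITY of the generic leaf**: `ω = 2 →` the profile is `y ↦ y + 1` on `[1, ∞)` (Huang–Pan /
Coppersmith saturation), hence differentiable at every `x > 1`. -/
theorem smooth_of_mm (h : _root_.MatrixMultiplication) :
    ∀ x : ℝ, 1 < x → DifferentiableAt ℝ (fun y : ℝ => omegaRect ℂ 1 y 1) x := by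
  intro x hx
  rw [_root_.MatrixMultiplication_iff] at h
  have hev : (fun y : ℝ => omegaRect ℂ 1 y 1) =ᶠ[𝓝 x] fun y : ℝ => y + 1 := by
    filter_upwards [Ioi_mem_nhds hx] with y hy
    exact saturated_of_omega_eq_two h (le_of_lt hy)
  have hd : DifferentiableAt ℝ (fun y : ℝ => y + 1) x := by fun_prop
  exact hd.congr_of_eventuallyEq hev

/-- **The regularity cut is exact** (spelled form):
`ω(ℂ) = 2 ⟺ TameProfile ∧ (ω(1,·,1) differentiable on (1, ∞))` — the profile is O-MINIMAL-TAME (semilinear)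
AND has NO FIRST-ORDER PHASE TRANSITION; `ω = 2` is exactly both. -/
theorem node_tameSmooth_iff_spelled : _root_.MatrixMultiplication ↔
    TameProfile ∧ ∀ x : ℝ, 1 < x → DifferentiableAt ℝ (fun y : ℝ => omegaRect ℂ 1 y 1) x :=
  ⟨fun h => ⟨tameProfile_of_mm h, smooth_of_mm h⟩, fun h => closes_tameSmooth h.1 h.2⟩

/-! ## §4 The aside `SmoothProfile` BY NAME -/

/-- The aside unfolds to the spelled statement. -/
theorem smoothProfile_iff : SmoothProfile ↔
    ∀ x : ℝ, 1 < x → DifferentiableAt ℝ (fun y : ℝ => omegaRect ℂ 1 y 1) x := Iff.rfl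

/-- **NEC**: `ω = 2 → SmoothProfile`. -/
theorem smoothProfile_of_mm (h : _root_.MatrixMultiplication) : SmoothProfile := smooth_of_mm h

/-- ★ **`closes` of the regularity cut, by name**: `TameProfile → SmoothProfile → ω(ℂ) = 2`. -/
theorem closes_tame_smooth (hT : TameProfile) (hD : SmoothProfile) : _root_.MatrixMultiplication :=
  closes_tameSmooth hT hD

/-- ★ **EXACT NODE, by name**: `ω(ℂ) = 2 ⟺ TameProfile ∧ SmoothProfile`. -/
theorem node_tameSmooth_iff : _root_.MatrixMultiplication ↔ TameProfile ∧ SmoothProfile :=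
  node_tameSmooth_iff_spelled

/-- The generic leaf alone is at most the summit: `(ω = 2 → SmoothProfile)`; with the record's special
leaf it does NOT close (world `tangentialWorld_*` below: `FiniteSaturation`-shape ∧ smooth ∧ `ω > 2`-shape) —
the pairing needs the STRONGER special leaf `TameProfile`. -/
theorem smoothProfile_sandwich :
    (_root_.MatrixMultiplication → SmoothProfile) ∧ (TameProfile → SmoothProfile → _root_.MatrixMultiplication) :=
  ⟨smoothProfile_of_mm, closes_tame_smooth⟩

/-! ## §5 Honesty: used contents of the two leaves (TRANSVERSAL CONTACT `TC`) -/

/-- A transversal contact forces `ω > 2` (at `x = 1`: `ω = ω(1,1,1) ≥ (b+1) − a(b−1) = 2 + (1−a)(b−1) > 2`). -/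
theorem not_mm_of_transversal
    (h : ∃ b a : ℝ, 1 < b ∧ a < 1 ∧ (∀ y : ℝ, b ≤ y → omegaRect ℂ 1 y 1 = y + 1) ∧
      ∀ x : ℝ, 1 ≤ x → x ≤ b → omegaRect ℂ 1 b 1 - a * (b - x) ≤ omegaRect ℂ 1 x 1) :
    ¬ _root_.MatrixMultiplication := by
  obtain ⟨b, a, hb, ha, hright, hleft⟩ := h
  intro hS
  rw [_root_.MatrixMultiplication_iff] at hS
  have h1 := hleft 1 le_rfl hb.le
  rw [hright b le_rfl, saturated_of_omega_eq_two hS le_rfl] at h1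
  nlinarith [mul_pos (sub_pos.2 ha) (sub_pos.2 hb)]

/-- A transversal contact is in particular a (real, hence integer) saturation: `TC → FiniteSaturation`. -/
theorem finiteSaturation_of_transversal
    (h : ∃ b a : ℝ, 1 < b ∧ a < 1 ∧ (∀ y : ℝ, b ≤ y → omegaRect ℂ 1 y 1 = y + 1) ∧
      ∀ x : ℝ, 1 ≤ x → x ≤ b → omegaRect ℂ 1 b 1 - a * (b - x) ≤ omegaRect ℂ 1 x 1) :
    FiniteSaturation := by
  obtain ⟨b, _a, hb, -, hright, -⟩ := h
  exact finiteSaturation_iff_realSaturation.2 ⟨b, hb, hright b le_rfl⟩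

/-- **USED CONTENT of the special leaf**: `TameProfile → (ω = 2 ∨ TC)`. -/
theorem tame_used (hT : TameProfile) : _root_.MatrixMultiplication ∨
    ∃ b a : ℝ, 1 < b ∧ a < 1 ∧ (∀ y : ℝ, b ≤ y → omegaRect ℂ 1 y 1 = y + 1) ∧
      ∀ x : ℝ, 1 ≤ x → x ≤ b → omegaRect ℂ 1 b 1 - a * (b - x) ≤ omegaRect ℂ 1 x 1 := by
  by_cases hS : _root_.MatrixMultiplication
  · exact Or.inl hS
  · exact Or.inr (transversal_of_tameProfile_of_not_mm hT hS)

/-- **USED CONTENT of the generic leaf**: `SmoothProfile → ¬TC` (tangential arrival at the last kink). -/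
theorem smooth_used (hD : SmoothProfile) :
    ¬ ∃ b a : ℝ, 1 < b ∧ a < 1 ∧ (∀ y : ℝ, b ≤ y → omegaRect ℂ 1 y 1 = y + 1) ∧
      ∀ x : ℝ, 1 ≤ x → x ≤ b → omegaRect ℂ 1 b 1 - a * (b - x) ≤ omegaRect ℂ 1 x 1 :=
  fun ⟨b, _, hb, ha, hright, hleft⟩ => not_differentiableAt_of_transversal hb ha hright hleft (hD b hb)

/-- The two used contents close by pure logic: `(S ∨ TC) → ¬TC → S`. -/
theorem closes_used
    (h₁ : _root_.MatrixMultiplication ∨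
      ∃ b a : ℝ, 1 < b ∧ a < 1 ∧ (∀ y : ℝ, b ≤ y → omegaRect ℂ 1 y 1 = y + 1) ∧
        ∀ x : ℝ, 1 ≤ x → x ≤ b → omegaRect ℂ 1 b 1 - a * (b - x) ≤ omegaRect ℂ 1 x 1)
    (h₂ : ¬ ∃ b a : ℝ, 1 < b ∧ a < 1 ∧ (∀ y : ℝ, b ≤ y → omegaRect ℂ 1 y 1 = y + 1) ∧
        ∀ x : ℝ, 1 ≤ x → x ≤ b → omegaRect ℂ 1 b 1 - a * (b - x) ≤ omegaRect ℂ 1 x 1) :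
    _root_.MatrixMultiplication :=
  h₁.resolve_right h₂

/-- **HONESTY**: the generic used content `¬TC` is EXACTLY the residual `TC → ω = 2` of the contact
statement (because `TC → ω > 2`), it is implied by the record's law (`AnchoredLogConvexity → ¬TC`, via the
route's `closes`) and by the record's residual (`(FiniteSaturation → ω = 2) → ¬TC`): at used-content level
the regularity leaf asks LESS than the law; what is new is the pairing with tameness. -/
theorem smoothUsed_iff_residual :
    (¬ ∃ b a : ℝ, 1 < b ∧ a < 1 ∧ (∀ y : ℝ, b ≤ y → omegaRect ℂ 1 y 1 = y + 1) ∧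
        ∀ x : ℝ, 1 ≤ x → x ≤ b → omegaRect ℂ 1 b 1 - a * (b - x) ≤ omegaRect ℂ 1 x 1) ↔
      ((∃ b a : ℝ, 1 < b ∧ a < 1 ∧ (∀ y : ℝ, b ≤ y → omegaRect ℂ 1 y 1 = y + 1) ∧
        ∀ x : ℝ, 1 ≤ x → x ≤ b → omegaRect ℂ 1 b 1 - a * (b - x) ≤ omegaRect ℂ 1 x 1) →
        _root_.MatrixMultiplication) :=
  ⟨fun h t => (h t).elim, fun h t => not_mm_of_transversal t (h t)⟩

/-- The record's RESIDUAL already forbids a transversal contact: `(FiniteSaturation → ω = 2) → ¬TC`. -/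
theorem not_transversal_of_residual (h : FiniteSaturation → _root_.MatrixMultiplication) :
    ¬ ∃ b a : ℝ, 1 < b ∧ a < 1 ∧ (∀ y : ℝ, b ≤ y → omegaRect ℂ 1 y 1 = y + 1) ∧
      ∀ x : ℝ, 1 ≤ x → x ≤ b → omegaRect ℂ 1 b 1 - a * (b - x) ≤ omegaRect ℂ 1 x 1 :=
  fun t => not_mm_of_transversal t (h (finiteSaturation_of_transversal t))

/-- The record's LAW forbids a transversal contact: `AnchoredLogConvexity → ¬TC` (through the route's `closes`). -/
theorem not_transversal_of_alc (hA : AnchoredLogConvexity) :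
    ¬ ∃ b a : ℝ, 1 < b ∧ a < 1 ∧ (∀ y : ℝ, b ≤ y → omegaRect ℂ 1 y 1 = y + 1) ∧
      ∀ x : ℝ, 1 ≤ x → x ≤ b → omegaRect ℂ 1 b 1 - a * (b - x) ≤ omegaRect ℂ 1 x 1 :=
  not_transversal_of_residual fun hF => closes hF hA

end Summit.MatrixMultiplication.MatrixMultiplication.Theorems.FarEdgeDescentSmoothCut

end
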